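import Mathlib
import HarnessLib
import Summits.ValiantsHypothesis.ValiantsHypothesis.Theorems.KPlusLogSqLawMixedGaugeFamilyDownward
import Summits.ValiantsHypothesis.ValiantsHypothesis.Theorems.KPlusLogSqLawMixedGaugeInertiaRefinedWindow
import Summits.ValiantsHypothesis.ValiantsHypothesis.Theorems.KPlusLogSqLawMixedGaugeKernelSplit
import Summits.ValiantsHypothesis.ValiantsHypothesis.Theorems.KPlusLogSqLawMixedGaugeTwoClassGeneralRatio

/-!
# Route «KPlusLogSqLaw», `WeakLifting` (stmt-ValiantsHypothesis-19561) — mixed-gauge series: THE BLOCK FAMILY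
# `x ↦ [[A + x^a·1, B], [Bᵀ, C − x^b·1]]` — symmetry, continuity, first-order form, and its two END SCALES

HONEST FRAMING.  Helper file (hand leafhand-val-kpluslogsqlaw-1 g14, 2026-08-31; `--supports stmt-ValiantsHypothesis-19561 --as helper`,
zero crux / stub credit), technical base of the LOCATED two-class mixed-gauge law at every ratio (sequel
`…MixedGaugeTwoClassAllRatios`).  Elementary facts about the real symmetric block family `F(x) = [[A + x^a·1ₙ, B], [Bᵀ, C − x^b·1ₘ]]`
(`A ∈ Sym(n)`, `C ∈ Sym(m)`, `B` any, `1 ≤ a`, `1 ≤ b`) in the currency of val-sym-mdr-p2's inertia kit (families `ℝ → Matrix ι ι ℝ`,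
`ι = Fin n ⊕ Fin m`): `blockFamily_isSymm`, `blockFamily_continuous`; the FIRST-ORDER FORM `F x = F t + (x − t)·G_t(x)` with the
geometric-sum blocks `G_t(x) = [[g_a(x,t)·1, 0], [0, −g_b(x,t)·1]]` (`blockFamily_firstOrder`, `diffFamily_continuous`; kernel form
`uᵀG_t(t)u = a t^{a−1}‖w‖² − b t^{b−1}‖q‖²`, `form_diagBlocks`); and the END SCALES: for `x ≥ 1` exceeding `Σ|Aᵢⱼ|` and `Σ|Cᵢⱼ|` the
matrix `F(x)` is NON-SINGULAR (`blockFamily_det_ne_zero_of_large`: a kernel vector `(w,q)` gives `wᵀ(A + x^a)w + qᵀ(x^b − C)q = 0` with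
both pieces definite) and its negative index is `≥ m` (`blockFamily_negIndex_ge_of_large`: the fast block is negative definite;
`Inertia.card_le_negIndex`).  Small helpers: `form_le_absSum_mul` (`qᵀCq ≤ (Σ|Cᵢⱼ|)‖q‖²`), `rank_lt_card_of_det_eq_zero`,
`sum_filter_sigma_fst`.  Nothing here is about `WeakLifting` / `TropicalB` in their windows, the registered stubs, the doors,
`MatrixDescartes` (18050) or VP ≠ VNP.  No `def`; axioms standard. [folklore]
-/

set_option linter.dupNamespace false
set_option autoImplicit false

namespace Summit.ValiantsHypothesis.ValiantsHypothesis.Theorems.KPlusLogSqLaw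

namespace MixedGauge

open Matrix Finset Polynomial
open scoped BigOperators Topology
open Summit.ValiantsHypothesis.ValiantsHypothesis.Theorems.LacunarySymmetroidMatrixDescartes
open Summit.ValiantsHypothesis.ValiantsHypothesis.Theorems.LacunarySymmetroidMatrixDescartes.Inertia

variable {n m : ℕ}

/-! ## 1. Small linear-algebra helpers -/

/-- the form of the diagonal block matrix `[[α·1, 0], [0, −β·1]]` on `(w, q)`. [folklore] -/
theorem form_diagBlocks (α β : ℝ) (w : Fin n → ℝ) (q : Fin m → ℝ) :
    Sum.elim w q ⬝ᵥ (Matrix.fromBlocks (α • (1 : Matrix (Fin n) (Fin n) ℝ)) 0 0 (-(β • (1 : Matrix (Fin m) (Fin m) ℝ))) *ᵥ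
      Sum.elim w q) = α * (w ⬝ᵥ w) - β * (q ⬝ᵥ q) := by
  rw [Matrix.fromBlocks_mulVec, Sum.elim_comp_inl, Sum.elim_comp_inr, Matrix.zero_mulVec, Matrix.zero_mulVec, add_zero,
    zero_add, Matrix.neg_mulVec, Matrix.smul_mulVec, Matrix.smul_mulVec, Matrix.one_mulVec, Matrix.one_mulVec,
    sumElim_dotProduct_sumElim, dotProduct_neg, dotProduct_smul, dotProduct_smul, smul_eq_mul, smul_eq_mul]
  ring

/-- a crude bound for a quadratic form: `qᵀCq ≤ (Σᵢⱼ |Cᵢⱼ|)·‖q‖²`. [folklore] -/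
theorem form_le_absSum_mul {k : ℕ} (C : Matrix (Fin k) (Fin k) ℝ) (q : Fin k → ℝ) :
    q ⬝ᵥ (C *ᵥ q) ≤ (∑ i, ∑ j, |C i j|) * (q ⬝ᵥ q) := by
  have hq2 : ∀ i, q i ^ 2 ≤ q ⬝ᵥ q := by
    intro i
    rw [dotProduct, sq]
    exact Finset.single_le_sum (f := fun l => q l * q l) (fun l _ => mul_self_nonneg (q l)) (Finset.mem_univ i)
  have hprod : ∀ i j, |q i| * |q j| ≤ q ⬝ᵥ q := by
    intro i j
    have h1 := hq2 i
    have h2 := hq2 j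
    have hsq : |q i| ^ 2 = q i ^ 2 := sq_abs _
    have hsq' : |q j| ^ 2 = q j ^ 2 := sq_abs _
    nlinarith [sq_nonneg (|q i| - |q j|), abs_nonneg (q i), abs_nonneg (q j)]
  calc q ⬝ᵥ (C *ᵥ q) = ∑ i, ∑ j, C i j * (q i * q j) := by
        rw [dotProduct]
        refine Finset.sum_congr rfl fun i _ => ?_
        rw [Matrix.mulVec, dotProduct, Finset.mul_sum]
        refine Finset.sum_congr rfl fun j _ => ?_
        ring
    _ ≤ ∑ i, ∑ j, |C i j| * (q ⬝ᵥ q) := by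
        refine Finset.sum_le_sum fun i _ => Finset.sum_le_sum fun j _ => ?_
        calc C i j * (q i * q j) ≤ |C i j * (q i * q j)| := le_abs_self _
          _ = |C i j| * (|q i| * |q j|) := by rw [abs_mul, abs_mul]
          _ ≤ |C i j| * (q ⬝ᵥ q) := mul_le_mul_of_nonneg_left (hprod i j) (abs_nonneg _)
    _ = (∑ i, ∑ j, |C i j|) * (q ⬝ᵥ q) := by rw [Finset.sum_mul]; simp_rw [Finset.sum_mul]

/-- a singular real matrix has rank below the size. [folklore] -/
theorem rank_lt_card_of_det_eq_zero {ι : Type} [Fintype ι] [DecidableEq ι] (M : Matrix ι ι ℝ) (hM : M.det = 0) :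
    M.rank < Fintype.card ι := by
  obtain ⟨v, hv0, hv⟩ := Matrix.exists_mulVec_eq_zero_iff.mpr hM
  have hker : LinearMap.ker M.mulVecLin ≠ ⊥ := by
    rw [Submodule.ne_bot_iff]
    exact ⟨v, by rw [LinearMap.mem_ker, Matrix.mulVecLin_apply]; exact hv, hv0⟩
  have hpos : 0 < Module.finrank ℝ (LinearMap.ker M.mulVecLin) := by
    rw [Module.finrank_pos_iff_exists_ne_zero]
    obtain ⟨w, hw, hw0⟩ := (Submodule.ne_bot_iff _).mp hker
    exact ⟨⟨w, hw⟩, fun h => hw0 (congrArg Subtype.val h)⟩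
  have h1 := LinearMap.finrank_range_add_finrank_ker M.mulVecLin
  rw [Module.finrank_fintype_fun_eq_card] at h1
  have h2 : M.rank = Module.finrank ℝ (LinearMap.range M.mulVecLin) := rfl
  omega

/-- sums over the fibre `{j | j.1 = s}` of a sigma type are sums over the summand. [folklore] -/
theorem sum_filter_sigma_fst {T : ℕ} {κ : Fin T → ℕ} {M : Type} [AddCommMonoid M]
    (f : (Σ s : Fin T, Fin (κ s)) → M) (s : Fin T) :
    ∑ j ∈ univ.filter (fun j : (Σ s : Fin T, Fin (κ s)) => j.1 = s), f j = ∑ i : Fin (κ s), f ⟨s, i⟩ := by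
  classical
  rw [Finset.sum_filter]
  rw [← Finset.univ_sigma_univ, Finset.sum_sigma]
  rw [Finset.sum_eq_single s]
  · simp
  · intro s' _ hs'
    simp [hs']
  · intro h; exact absurd (Finset.mem_univ s) h

end MixedGauge

end Summit.ValiantsHypothesis.ValiantsHypothesis.Theorems.KPlusLogSqLaw

namespace Summit.ValiantsHypothesis.ValiantsHypothesis.Theorems.KPlusLogSqLaw

namespace MixedGauge

open Matrix Finset Polynomial
open scoped BigOperators Topology
open Summit.ValiantsHypothesis.ValiantsHypothesis.Theorems.LacunarySymmetroidMatrixDescartes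
open Summit.ValiantsHypothesis.ValiantsHypothesis.Theorems.LacunarySymmetroidMatrixDescartes.Inertia

variable {n m : ℕ}

/-! ## 2. The block family, its first-order form and its ends -/

section Family

variable (A : Matrix (Fin n) (Fin n) ℝ) (C : Matrix (Fin m) (Fin m) ℝ) (B : Matrix (Fin n) (Fin m) ℝ) (a b : ℕ)

/-- the real symmetric block family `x ↦ [[A + x^a·1, B], [Bᵀ, C − x^b·1]]` is symmetric. [folklore] -/
theorem blockFamily_isSymm (hA : A.IsSymm) (hC : C.IsSymm) (x : ℝ) :
    (Matrix.fromBlocks (A + (x ^ a) • (1 : Matrix (Fin n) (Fin n) ℝ)) B Bᵀ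
      (C - (x ^ b) • (1 : Matrix (Fin m) (Fin m) ℝ))).IsSymm :=
  Matrix.IsSymm.fromBlocks (hA.add (Matrix.isSymm_one.smul _)) rfl (hC.sub (Matrix.isSymm_one.smul _))

/-- entrywise continuity of the block family. [folklore] -/
theorem blockFamily_continuous (i j : Fin n ⊕ Fin m) :
    Continuous fun x : ℝ => (Matrix.fromBlocks (A + (x ^ a) • (1 : Matrix (Fin n) (Fin n) ℝ)) B Bᵀ
      (C - (x ^ b) • (1 : Matrix (Fin m) (Fin m) ℝ))) i j := by
  rcases i with i | i <;> rcases j with j | j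
  · simp only [Matrix.fromBlocks_apply₁₁, Matrix.add_apply, Matrix.smul_apply, smul_eq_mul]
    fun_prop
  · simp only [Matrix.fromBlocks_apply₁₂]
    fun_prop
  · simp only [Matrix.fromBlocks_apply₂₁]
    fun_prop
  · simp only [Matrix.fromBlocks_apply₂₂, Matrix.sub_apply, Matrix.smul_apply, smul_eq_mul]
    fun_prop

/-- entrywise continuity of the difference-quotient family. [folklore] -/
theorem diffFamily_continuous (t : ℝ) (i j : Fin n ⊕ Fin m) :
    Continuous fun x : ℝ => (Matrix.fromBlocks ((∑ l ∈ range a, x ^ l * t ^ (a - 1 - l)) • (1 : Matrix (Fin n) (Fin n) ℝ)) 0 0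
      (-((∑ l ∈ range b, x ^ l * t ^ (b - 1 - l)) • (1 : Matrix (Fin m) (Fin m) ℝ)))) i j := by
  rcases i with i | i <;> rcases j with j | j
  · simp only [Matrix.fromBlocks_apply₁₁, Matrix.smul_apply, smul_eq_mul]
    fun_prop
  · simp only [Matrix.fromBlocks_apply₁₂, Matrix.zero_apply]
    fun_prop
  · simp only [Matrix.fromBlocks_apply₂₁, Matrix.zero_apply]
    fun_prop
  · simp only [Matrix.fromBlocks_apply₂₂, Matrix.neg_apply, Matrix.smul_apply, smul_eq_mul]
    fun_prop

/-- the first-order form of the block family at `t`: `F x = F t + (x − t) • G_t x` with the geometric-sum blocks. [folklore] -/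
theorem blockFamily_firstOrder (t x : ℝ) :
    Matrix.fromBlocks (A + (x ^ a) • (1 : Matrix (Fin n) (Fin n) ℝ)) B Bᵀ (C - (x ^ b) • (1 : Matrix (Fin m) (Fin m) ℝ))
      = Matrix.fromBlocks (A + (t ^ a) • (1 : Matrix (Fin n) (Fin n) ℝ)) B Bᵀ (C - (t ^ b) • (1 : Matrix (Fin m) (Fin m) ℝ))
        + (x - t) • Matrix.fromBlocks ((∑ l ∈ range a, x ^ l * t ^ (a - 1 - l)) • (1 : Matrix (Fin n) (Fin n) ℝ)) 0 0
            (-((∑ l ∈ range b, x ^ l * t ^ (b - 1 - l)) • (1 : Matrix (Fin m) (Fin m) ℝ))) := by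
  have hga : x ^ a = t ^ a + (x - t) * ∑ l ∈ range a, x ^ l * t ^ (a - 1 - l) := by
    have := (Commute.all x t).geom_sum₂_mul a
    linear_combination -this
  have hgb : x ^ b = t ^ b + (x - t) * ∑ l ∈ range b, x ^ l * t ^ (b - 1 - l) := by
    have := (Commute.all x t).geom_sum₂_mul b
    linear_combination -this
  rw [Matrix.fromBlocks_smul, Matrix.fromBlocks_add, smul_zero, smul_zero, add_zero, add_zero]
  congr 1
  · rw [hga, add_smul, smul_smul, add_assoc]
  · rw [hgb, add_smul, smul_neg, smul_smul, sub_add_eq_sub_sub, sub_eq_add_neg]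

/-- at a large scale the block family has a non-trivial kernel only trivially: if `x ≥ 1`, `x > Σ|Aᵢⱼ|` and `x > Σ|Cᵢⱼ|`
then `[[A + x^a·1, B], [Bᵀ, C − x^b·1]]` (`1 ≤ a`, `1 ≤ b`) is non-singular. [folklore] -/
theorem blockFamily_det_ne_zero_of_large (ha : 1 ≤ a) (hb : 1 ≤ b) (x : ℝ) (hx1 : 1 ≤ x)
    (hxA : ∑ i, ∑ j, |A i j| < x) (hxC : ∑ i, ∑ j, |C i j| < x) :
    (Matrix.fromBlocks (A + (x ^ a) • (1 : Matrix (Fin n) (Fin n) ℝ)) B Bᵀ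
      (C - (x ^ b) • (1 : Matrix (Fin m) (Fin m) ℝ))).det ≠ 0 := by
  intro hdet
  obtain ⟨u, hu0, hu⟩ := Matrix.exists_mulVec_eq_zero_iff.mpr hdet
  set w : Fin n → ℝ := u ∘ Sum.inl with hw
  set q : Fin m → ℝ := u ∘ Sum.inr with hq
  have huwq : u = Sum.elim w q := by
    funext i; rcases i with i | i <;> rfl
  rw [huwq, Matrix.fromBlocks_mulVec] at hu
  have h1 : (A + (x ^ a) • (1 : Matrix (Fin n) (Fin n) ℝ)) *ᵥ w + B *ᵥ q = 0 := by
    funext i; have := congrFun hu (Sum.inl i); simpa using this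
  have h2 : Bᵀ *ᵥ w + (C - (x ^ b) • (1 : Matrix (Fin m) (Fin m) ℝ)) *ᵥ q = 0 := by
    funext i; have := congrFun hu (Sum.inr i); simpa using this
  -- wᵀ(A + x^a)w = −wᵀBq and qᵀ(C − x^b)q = −qᵀBᵀw = −wᵀBq
  have e1 : w ⬝ᵥ ((A + (x ^ a) • (1 : Matrix (Fin n) (Fin n) ℝ)) *ᵥ w) + w ⬝ᵥ (B *ᵥ q) = 0 := by
    rw [← dotProduct_add, h1, dotProduct_zero]
  have e2 : q ⬝ᵥ (Bᵀ *ᵥ w) + q ⬝ᵥ ((C - (x ^ b) • (1 : Matrix (Fin m) (Fin m) ℝ)) *ᵥ q) = 0 := by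
    rw [← dotProduct_add, h2, dotProduct_zero]
  have e3 : q ⬝ᵥ (Bᵀ *ᵥ w) = w ⬝ᵥ (B *ᵥ q) := by
    rw [Matrix.dotProduct_mulVec, Matrix.vecMul_transpose, dotProduct_comm]
  -- the two definite pieces
  have hxa : x ≤ x ^ a := le_self_pow₀ hx1 (by omega)
  have hxb : x ≤ x ^ b := le_self_pow₀ hx1 (by omega)
  have hAw : w ⬝ᵥ ((A + (x ^ a) • (1 : Matrix (Fin n) (Fin n) ℝ)) *ᵥ w) = w ⬝ᵥ (A *ᵥ w) + x ^ a * (w ⬝ᵥ w) := by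
    rw [Matrix.add_mulVec, dotProduct_add, Matrix.smul_mulVec, Matrix.one_mulVec, dotProduct_smul, smul_eq_mul]
  have hCq : q ⬝ᵥ ((C - (x ^ b) • (1 : Matrix (Fin m) (Fin m) ℝ)) *ᵥ q) = q ⬝ᵥ (C *ᵥ q) - x ^ b * (q ⬝ᵥ q) := by
    rw [Matrix.sub_mulVec, dotProduct_sub, Matrix.smul_mulVec, Matrix.one_mulVec, dotProduct_smul, smul_eq_mul]
  have hbA' := form_le_absSum_mul (-A) w
  have hbC := form_le_absSum_mul C q
  have hnegA : ∑ i, ∑ j, |(-A) i j| = ∑ i, ∑ j, |A i j| := by simp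
  rw [hnegA, Matrix.neg_mulVec, dotProduct_neg] at hbA'
  have hww : 0 ≤ w ⬝ᵥ w := by rw [dotProduct]; exact Finset.sum_nonneg fun i _ => mul_self_nonneg _
  have hqq : 0 ≤ q ⬝ᵥ q := by rw [dotProduct]; exact Finset.sum_nonneg fun i _ => mul_self_nonneg _
  -- sum of the two pieces vanishes
  have hsum : (w ⬝ᵥ (A *ᵥ w) + x ^ a * (w ⬝ᵥ w)) + (x ^ b * (q ⬝ᵥ q) - q ⬝ᵥ (C *ᵥ q)) = 0 := by
    rw [hAw] at e1; rw [hCq, e3] at e2; linarith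
  -- each piece is ≥ 0 and > 0 unless the vector vanishes
  have hcA : 0 < x ^ a - ∑ i, ∑ j, |A i j| := by linarith
  have hcC : 0 < x ^ b - ∑ i, ∑ j, |C i j| := by linarith
  have hp1 : 0 ≤ w ⬝ᵥ (A *ᵥ w) + x ^ a * (w ⬝ᵥ w) := by nlinarith [mul_nonneg hcA.le hww]
  have hp2 : 0 ≤ x ^ b * (q ⬝ᵥ q) - q ⬝ᵥ (C *ᵥ q) := by nlinarith [mul_nonneg hcC.le hqq]
  have hz1 : w ⬝ᵥ (A *ᵥ w) + x ^ a * (w ⬝ᵥ w) = 0 := by linarith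
  have hz2 : x ^ b * (q ⬝ᵥ q) - q ⬝ᵥ (C *ᵥ q) = 0 := by linarith
  have hw0 : w ⬝ᵥ w = 0 := by
    by_contra hne
    have hpos : 0 < w ⬝ᵥ w := lt_of_le_of_ne hww (Ne.symm hne)
    nlinarith [mul_pos hcA hpos]
  have hq0 : q ⬝ᵥ q = 0 := by
    by_contra hne
    have hpos : 0 < q ⬝ᵥ q := lt_of_le_of_ne hqq (Ne.symm hne)
    nlinarith [mul_pos hcC hpos]
  apply hu0
  rw [huwq, dotProduct_self_eq_zero.mp hw0, dotProduct_self_eq_zero.mp hq0]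
  funext i; rcases i with i | i <;> rfl

/-- at a large scale the fast block is negative definite: `ν ≥ m`. [folklore] -/
theorem blockFamily_negIndex_ge_of_large (hA : A.IsSymm) (hC : C.IsSymm) (hb : 1 ≤ b) (x : ℝ) (hx1 : 1 ≤ x)
    (hxC : ∑ i, ∑ j, |C i j| < x) :
    m ≤ Fintype.card {j // (isHermitian_of_isSymm (blockFamily_isSymm A C B a b hA hC x)).eigenvalues j < 0} := by
  have h := card_le_negIndex (isHermitian_of_isSymm (blockFamily_isSymm A C B a b hA hC x))
    (fun i : Fin m => Sum.elim (0 : Fin n → ℝ) (Pi.single i (1 : ℝ) : Fin m → ℝ)) ?_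
  · simpa using h
  intro c hc
  have hcomb : (∑ i, c i • Sum.elim (0 : Fin n → ℝ) (Pi.single i (1 : ℝ) : Fin m → ℝ)) = Sum.elim (0 : Fin n → ℝ) c := by
    funext l
    rcases l with l | l
    · simp [Finset.sum_apply]
    · simp [Finset.sum_apply, Pi.single_apply]
  rw [hcomb, Matrix.fromBlocks_mulVec, Sum.elim_comp_inl, Sum.elim_comp_inr, Matrix.mulVec_zero, Matrix.mulVec_zero,
    zero_add, zero_add, sumElim_dotProduct_sumElim, zero_dotProduct, zero_add, Matrix.sub_mulVec, dotProduct_sub,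
    Matrix.smul_mulVec, Matrix.one_mulVec, dotProduct_smul, smul_eq_mul]
  have hbC := form_le_absSum_mul C c
  have hxb : x ≤ x ^ b := le_self_pow₀ hx1 (by omega)
  have hcc : 0 < c ⬝ᵥ c := by
    rw [dotProduct]
    obtain ⟨i, hi⟩ : ∃ i, c i ≠ 0 := by
      by_contra h; push Not at h; exact hc (funext h)
    exact lt_of_lt_of_le (mul_self_pos.mpr hi) (Finset.single_le_sum (f := fun l => c l * c l)
      (fun l _ => mul_self_nonneg _) (Finset.mem_univ i))
  have hcoef : 0 < x ^ b - ∑ i, ∑ j, |C i j| := by linarith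
  nlinarith [mul_pos hcoef hcc]

end Family

end MixedGauge

end Summit.ValiantsHypothesis.ValiantsHypothesis.Theorems.KPlusLogSqLaw
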